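import Summits.CriticalPhenomena.PercolationContinuityZ3.Theorems.FK.FreeEdwardsSokalLRO
import Summits.CriticalPhenomena.PercolationContinuityZ3.Theorems.FK.InfiniteVolumeDefs
import Literature.Probability.Percolation.LocalLimitConnections
import Literature.Probability.Percolation.UniqueClusterDensityBound
import Literature.Probability.Percolation.PositiveAssociation
import Literature.Probability.LatticeModels.GriffithsMonotonicity
import HarnessLib

/-!
# Free Edwards–Sokal in infinite volume: `φ⁰_{p,2}(x ↔ y) = ⟨σ_xσ_y⟩^∅_β`, and `θ⁰² ≲ M̃_LRO(β)²`

fk-continuity build cell, row FO-03b′ (`--supports stmt-CriticalPhenomena-4575`, helper); builds on p205010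
(kernel theorem, internal audit signed; external expert review pending). Sorry-free, standard axioms, no
named facts, no new definitions.

The zero form of Grimmett 2006 Thm. (5.17) eq. (5.18) at `q = 2` (`θ⁰(p,2) = 0 ⟺ M̃_LRO(β) = 0`) is in
`ContinuityTransferTwo.lean`. This file supplies the quantitative half along Grimmett's route (proof of
(5.18), p. 107) for ANY free box limit `P` (`IsBoxLimit d false p q P`, `InfiniteVolumeDefs.lean`):

* `FK.IsBoxLimit.tendsto_rcBoxLaw_real_openConn` — `φ⁰_{Λ_n,p,q}(x ↔ y) → P(x ↔ y)` (`q ≥ 1`,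
  `0 ≤ p ≤ 1`): the free two-point connectivity is the limit of the finite-volume ones although
  `{x ↔ y}` is not local (`{x ↔ y} = ⋃_N {x ↔ y inside Λ_N}`, (4.24) `FK.monotone_rcBoxLaw_false_real`,
  and the local limit); `FK.IsBoxLimit.rcBoxLaw_real_openConn_le` — `φ⁰_{Λ_n}(x ↔ y) ≤ P(x ↔ y)`;
* **`FK.IsBoxLimit.real_openConn_eq_freePair`** — infinite-volume Edwards–Sokal at `q = 2`:
  `P(x ↔ y) = ⟨σ_xσ_y⟩^∅_{β,0}` (`p = 1 - e^{-2β}`, `β ≥ 0`; Grimmett 2006 Thm. (4.91), first display of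
  the proof of (5.18): `(1 - q⁻¹) φ⁰_{p,q}(0 ↔ u) = π_{β,q}(σ_0 = σ_u) - q⁻¹`);
* **`FK.IsBoxLimit.sq_real_percolatesAt_le_freePair`** — (5.32) lower half, pointwise:
  `P(0 ↔ ∞)² ≤ ⟨σ_xσ_y⟩^∅_β`, given positive association, translation invariance, a.s. uniqueness;
* **`FK.IsBoxLimit.sq_real_percolatesAt_le_lroTildeSq`** — `P(0 ↔ ∞)² ≤ M̃_LRO(β)²` given translation
  invariance and a.s. uniqueness (no FKG: ADS15 Thm. 3.1's Cauchy–Schwarz density bound applied to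
  `φ⁰`); `…_le_two_mul_lroTildeSq` — `≤ 2 M̃_LRO(β)²` from "no three infinite clusters" (the half of
  Burton–Keane needing only translation invariance + insertion tolerance);
* **`FK.IsBoxLimit.measure_percolatesAt_eq_zero_of_lroTildeSq_eq_zero`** — `M̃_LRO(β) = 0 ⇒ P(x ↔ ∞) = 0`
  (`d ≥ 1`): row FO-03b by percolation methods (no random currents), the hypotheses `hS/hT/hI` being
  verbatim the conclusions of `IsBoxLimit.ae_subset_edgeSet` / `.measurePreserving_relabel_shift` /
  `.insertion_tolerant` of the cell's construction files (discharged there for `rcLimit d false p 2`).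

`P(0 ↔ ∞) = θ⁰(p,q)` (`thetaFree`, row FO-07) is neither proved nor assumed here. With FO-03a
(`M̃_LRO(β)² ≤ θ⁰(p,2)`): `θ⁰(p,2)² ≤ M̃_LRO(β)² ≤ θ⁰(p,2)` modulo FO-07/FO-08.

References: G. Grimmett, *The Random-Cluster Model* (2006), Thm. (4.19)(a)–(b), eq. (4.24), Thm. (4.91),
Thm. (5.17) with the proof of (5.18) and (5.32), p. 107 [Grimmett2006]; M. Aizenman, H. Duminil-Copin,
V. Sidoravicius, CMP 334 (2015), Thm. 3.1, (3.3)–(3.5) [AizenmanDuminilCopinSidoraviciusCMP2015];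
R. M. Burton, M. Keane, CMP 121 (1989) 501–505 [BurtonKeane1989].
-/

noncomputable section

namespace Summit.CriticalPhenomena.PercolationContinuityZ3.Theorems

namespace FK

open MeasureTheory Finset SimpleGraph Filter Topology
open Literature.Probability.LatticeModels Literature.Barriers.CriticalPhenomena
open Literature.Probability.Percolation

variable {d : ℕ}

/-! ### The lattice event `{x ↔ y}` read on a box -/

/-- **`{x ↔ y}` read through the lift**: for `x, y ∈ Λ`, a configuration `ω` of the finite piece `Λ`
(vertex type `↥Λ`), read on `ℤ^d` with the edges off `Λ` closed (`liftEdges Λ ω`), joins `x` to `y` iff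
`ω` joins `⟨x⟩` to `⟨y⟩`: every open edge of the lift has both endpoints in `Λ`, so open paths of the lift
are open paths of `ω`. [cite: Grimmett2006, §4.2 (configurations on E_Λ, extended by 0 off Λ)] -/
theorem liftEdges_preimage_openConn (Λ : Finset (Site d)) {x y : Site d} (hx : x ∈ Λ) (hy : y ∈ Λ) :
    liftEdges Λ ⁻¹' (openConn x y) = openConn (⟨x, hx⟩ : ↥Λ) ⟨y, hy⟩ := by
  ext ω
  simp only [Set.mem_preimage, openConn, Set.mem_setOf_eq]
  constructor
  · rintro ⟨w⟩
    -- walk along the open path of the lift, carrying membership in `Λ`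
    suffices h : ∀ (u v : Site d) (_ : (openGraph (liftEdges Λ ω)).Walk u v) (hu : u ∈ Λ)
        (hv : v ∈ Λ), (openGraph ω).Reachable (⟨u, hu⟩ : ↥Λ) ⟨v, hv⟩ from h x y w hx hy
    intro u v w
    induction w with
    | nil => exact fun _ _ => Reachable.refl _
    | @cons a b c hab w ih =>
      intro ha hc
      rw [openGraph_adj] at hab
      obtain ⟨⟨e', he', hee'⟩, hne⟩ := hab
      -- the open edge `s(a,b)` of the lift is the image of an open edge of `ω`, so `b ∈ Λ`
      obtain ⟨hb, hmem⟩ : ∃ hb : b ∈ Λ, s((⟨a, ha⟩ : ↥Λ), ⟨b, hb⟩) ∈ ω := by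
        induction e' using Sym2.ind with
        | h a' b' =>
          rw [Sym2.map_mk, Sym2.eq_iff] at hee'
          rcases hee' with ⟨h1, h2⟩ | ⟨h1, h2⟩
          · subst h1; subst h2
            exact ⟨b'.2, he'⟩
          · subst h1; subst h2
            rw [Sym2.eq_swap] at he'
            exact ⟨a'.2, he'⟩
      have hadj : (openGraph ω).Adj (⟨a, ha⟩ : ↥Λ) ⟨b, hb⟩ := by
        rw [openGraph_adj]
        exact ⟨hmem, fun h => hne (congrArg Subtype.val h)⟩
      exact hadj.reachable.trans (ih hb hc)
  · intro h
    -- the inclusion `↥Λ → ℤ^d` is a homomorphism of open graphs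
    let φ : openGraph ω →g openGraph (liftEdges Λ ω) :=
      { toFun := Subtype.val
        map_rel' := fun {a b} hab => by
          rw [openGraph_adj] at hab ⊢
          exact ⟨⟨s(a, b), hab.1, by rw [Sym2.map_mk]⟩, fun hab' => hab.2 (Subtype.ext hab')⟩ }
    exact h.map φ

/-- **The box law of `{x ↔ y}` is the box measure of `{x ↔ y}`** (`x, y ∈ Λ_n`, either boundary
condition): `(rcBoxLaw d b p q n)(x ↔ y) = φ^b_{Λ_n,p,q}(⟨x⟩ ↔ ⟨y⟩)`. [cite: Grimmett2006, §4.2 (4.11)–(4.12) and §4.3] -/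
theorem rcBoxLaw_real_openConn (b : Bool) (p q : ℝ) {n : ℕ} {x y : Site d} (hx : x ∈ box d n)
    (hy : y ∈ box d n) :
    (rcBoxLaw d b p q n).real (openConn x y) =
      (rcBoxMeasure d b p q n).real (openConn (⟨x, hx⟩ : ↥(box d n)) ⟨y, hy⟩) := by
  rw [measureReal_def, measureReal_def, rcBoxLaw,
    Measure.map_apply (measurable_of_finite _) (measurableSet_openConn_holds x y),
    liftEdges_preimage_openConn]

/-- **Finite-volume Edwards–Sokal, read on `ℤ^d`** (`q = 2`, free boundary condition, `β ≥ 0`,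
`p = 1 - e^{-2β}`, `x, y ∈ Λ_n`): `(rcBoxLaw d false p 2 n)(x ↔ y) = ⟨σ_xσ_y⟩^∅_{Λ_n;β,0}` (the tree's
`edwardsSokal_twoPoint_holds`, via `FK.isingTwoPoint_free_box_eq_rcMeasure_real_openConn`).
[cite: Grimmett2006, Thm. (1.16)] [cite: EdwardsSokal1988] -/
theorem rcBoxLaw_real_openConn_eq_isingTwoPoint {β : ℝ} (hβ : 0 ≤ β) {n : ℕ} {x y : Site d}
    (hx : x ∈ box d n) (hy : y ∈ box d n) :
    (rcBoxLaw d false (fkIsingParam β) 2 n).real (openConn x y) =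
      isingTwoPoint (zdGraph d) (box d n) β 0 .free x y := by
  rw [rcBoxLaw_real_openConn false _ _ hx hy, rcBoxMeasure_false,
    isingTwoPoint_free_box_eq_rcMeasure_real_openConn hβ hx hy]

/-! ### Grimmett's (4.24): the free box laws increase with the box on increasing events -/

/-- **(4.24), free, for every increasing event of `ℤ^d`** (`0 ≤ p ≤ 1`, `q ≥ 1`): `n ↦ φ⁰_{Λ_n,p,q}(A)`
(box laws read on `ℤ^d`) is non-decreasing for every increasing measurable `A` (no locality needed):
`φ⁰_{Λ_m} ≤_st (φ⁰_{Λ_n})|_{E(Λ_m)}` (`rcMeasure_real_box_free_le_restrict`), and restricting a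
configuration of `Λ_n` to `Λ_m` and lifting to `ℤ^d` gives a sub-configuration of its lift.
[cite: Grimmett2006, Thm. (4.19)(a), proof, eq. (4.24)] -/
theorem monotone_rcBoxLaw_false_real {p q : ℝ} (hp : p ∈ Set.Icc (0 : ℝ) 1) (hq : 1 ≤ q)
    {A : Set (BondConfig (Site d))} (hA : IsUpperSet A) (hAm : MeasurableSet A) :
    Monotone fun n : ℕ => (rcBoxLaw d false p q n).real A := by
  intro m n hmn
  haveI : IsProbabilityMeasure (rcBoxMeasure d false p q n) :=
    isProbabilityMeasure_rcMeasure _ hp (one_pos.trans_le hq) _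
  have happ : ∀ k, (rcBoxLaw d false p q k).real A =
      (rcBoxMeasure d false p q k).real (liftEdges (box d k) ⁻¹' A) := fun k => by
    rw [measureReal_def, measureReal_def, rcBoxLaw, Measure.map_apply (measurable_of_finite _) hAm]
  -- the restriction to `Λ_m`, lifted, is a sub-configuration of the lift
  have hsub : ∀ ω : BondConfig ↥(box d n),
      liftEdges (box d m) (finsetRestrict (box_mono d hmn) ω) ⊆ liftEdges (box d n) ω := by
    rintro ω e ⟨e', he', rfl⟩
    refine ⟨edgeLift (box_mono d hmn) e', (mem_finsetRestrict_iff _ _ _).1 he', ?_⟩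
    induction e' using Sym2.ind with
    | h a b => simp only [edgeLift_mk, Sym2.map_mk, finsetIncl_coe]
  simp only [happ]
  calc (rcBoxMeasure d false p q m).real (liftEdges (box d m) ⁻¹' A)
      ≤ (rcBoxMeasure d false p q n).real
          (finsetRestrict (box_mono d hmn) ⁻¹' (liftEdges (box d m) ⁻¹' A)) :=
        rcMeasure_real_box_free_le_restrict hmn hp hq (hA.preimage fun _ _ h => Set.image_mono h)
    _ ≤ (rcBoxMeasure d false p q n).real (liftEdges (box d n) ⁻¹' A) :=
        measureReal_mono fun ω hω => hA (hsub ω) hω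

/-! ### The free two-point connectivity in infinite volume: `φ⁰_{Λ_n,p,q}(x ↔ y) → P(x ↔ y)` -/

section Limit

variable {p q : ℝ} {P : Measure (BondConfig (Site d))}

/-- `φ⁰_{Λ_n,p,q}(x ↔ y inside Λ_N) ≤ P(x ↔ y inside Λ_N)` for every `n` (free box probabilities of an
increasing local event increase to their limit; Grimmett 2006, proof of Thm. (4.19)(b), p. 78).
[cite: Grimmett2006, Thm. (4.19)(b), proof (p. 78)] -/
theorem IsBoxLimit.rcBoxLaw_real_openConnVia_box_le (hP : IsBoxLimit d false p q P)
    (hp : p ∈ Set.Icc (0 : ℝ) 1) (hq : 1 ≤ q) (x y : Site d) (N n : ℕ) :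
    (rcBoxLaw d false p q n).real (openConnVia (withinGraph ⊤ (↑(box d N) : Set (Site d))) x y) ≤
      P.real (openConnVia (withinGraph ⊤ (↑(box d N) : Set (Site d))) x y) := by
  haveI := hP.isProbabilityMeasure
  set C : Set (BondConfig (Site d)) := openConnVia (withinGraph ⊤ (↑(box d N) : Set (Site d))) x y
  have hCloc : IsLocalEvent C := isLocalEvent_openConnVia_withinGraph_box N x y
  have hCm : MeasurableSet C := measurableSet_of_isLocalEvent_holds hCloc
  have hmono : Monotone fun k : ℕ => (rcBoxLaw d false p q k).real C :=
    monotone_rcBoxLaw_false_real hp hq (isUpperSet_openConnVia _ x y) hCm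
  have hlim : Tendsto (fun k : ℕ => (rcBoxLaw d false p q k).real C) atTop (𝓝 (P.real C)) :=
    (ENNReal.tendsto_toReal (measure_ne_top P C)).comp (hP.tendsto_of_isLocalEvent C hCloc)
  exact hmono.ge_of_tendsto hlim n

/-- **`φ⁰_{Λ_n,p,q}(x ↔ y) ≤ P(x ↔ y)` for every `n`** (free box limit `P`, `0 ≤ p ≤ 1`, `q ≥ 1`):
`{x ↔ y} = ⋃_N {x ↔ y inside Λ_N}` is an increasing union of increasing local events, on each of which
the box law is below `P`. [cite: Grimmett2006, Thm. (4.19)(b), proof (p. 78), with Thm. (5.17), proof p. 107] -/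
theorem IsBoxLimit.rcBoxLaw_real_openConn_le (hP : IsBoxLimit d false p q P)
    (hp : p ∈ Set.Icc (0 : ℝ) 1) (hq : 1 ≤ q) (x y : Site d) (n : ℕ) :
    (rcBoxLaw d false p q n).real (openConn x y) ≤ P.real (openConn x y) := by
  haveI := hP.isProbabilityMeasure
  haveI : IsProbabilityMeasure (rcBoxMeasure d false p q n) :=
    isProbabilityMeasure_rcMeasure _ hp (one_pos.trans_le hq) _
  haveI : IsProbabilityMeasure (rcBoxLaw d false p q n) :=
    Measure.isProbabilityMeasure_map (measurable_of_finite _).aemeasurable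
  set C : ℕ → Set (BondConfig (Site d)) := fun N =>
    openConnVia (withinGraph ⊤ (↑(box d N) : Set (Site d))) x y with hC
  have hmonoC : Monotone C := monotone_openConnVia_withinGraph_box x y
  have hU : (openConn x y : Set (BondConfig (Site d))) = ⋃ N, C N := openConn_eq_iUnion_openConnVia_box x y
  -- continuity from below for the box law
  have hlim : Tendsto (fun N => (rcBoxLaw d false p q n).real (C N)) atTop
      (𝓝 ((rcBoxLaw d false p q n).real (⋃ N, C N))) :=
    (ENNReal.tendsto_toReal (measure_ne_top _ _)).comp (tendsto_measure_iUnion_atTop hmonoC)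
  rw [hU]
  refine le_of_tendsto' hlim fun N => ?_
  calc (rcBoxLaw d false p q n).real (C N) ≤ P.real (C N) :=
        hP.rcBoxLaw_real_openConnVia_box_le hp hq x y N n
    _ ≤ P.real (⋃ N, C N) := measureReal_mono (Set.subset_iUnion C N)

/-- **The free two-point connectivity function is the limit of the finite-volume ones**: for every free
box limit `P` on `ℤ^d` (`0 ≤ p ≤ 1`, `q ≥ 1`) and all `x, y`, `φ⁰_{Λ_n,p,q}(x ↔ y) → P(x ↔ y)` — although
`{x ↔ y}` is not a local event: the sequence is non-decreasing ((4.24)) and bounded by `P(x ↔ y)`, and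
`P(x ↔ y) ≤ lim` since `{x ↔ y} = ⋃_N {x ↔ y inside Λ_N}` (tree `measure_openConn_le_of_eventually_le`).
The passage to infinite volume in the first display of the proof of Grimmett 2006 (5.18), p. 107.
[cite: Grimmett2006, Thm. (5.17), proof of (5.18), p. 107, with Thm. (4.19)(a)–(b)] -/
theorem IsBoxLimit.tendsto_rcBoxLaw_real_openConn (hP : IsBoxLimit d false p q P)
    (hp : p ∈ Set.Icc (0 : ℝ) 1) (hq : 1 ≤ q) (x y : Site d) :
    Tendsto (fun n : ℕ => (rcBoxLaw d false p q n).real (openConn x y)) atTop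
      (𝓝 (P.real (openConn x y))) := by
  haveI := hP.isProbabilityMeasure
  set a : ℕ → ℝ := fun n => (rcBoxLaw d false p q n).real (openConn x y) with ha
  have hmono : Monotone a :=
    monotone_rcBoxLaw_false_real hp hq (isUpperSet_openConn x y) (measurableSet_openConn_holds x y)
  have hle : ∀ n, a n ≤ P.real (openConn x y) := fun n => hP.rcBoxLaw_real_openConn_le hp hq x y n
  have hbdd : BddAbove (Set.range a) := ⟨P.real (openConn x y), by rintro _ ⟨n, rfl⟩; exact hle n⟩
  -- the monotone bounded sequence converges to its supremum `ℓ ≤ P(x ↔ y)`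
  set ℓ : ℝ := ⨆ n, a n with hℓ
  have hconv : Tendsto a atTop (𝓝 ℓ) := tendsto_atTop_ciSup hmono hbdd
  have hℓle : ℓ ≤ P.real (openConn x y) := ciSup_le hle
  -- and `P(x ↔ y) ≤ ℓ` through the box-constrained connections
  have hPle : P (openConn x y) ≤ ENNReal.ofReal ℓ := by
    refine measure_openConn_le_of_eventually_le hP.tendsto_of_isLocalEvent fun N => ?_
    refine Eventually.of_forall fun n => ?_
    haveI : IsProbabilityMeasure (rcBoxMeasure d false p q n) :=
      isProbabilityMeasure_rcMeasure _ hp (one_pos.trans_le hq) _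
    haveI : IsProbabilityMeasure (rcBoxLaw d false p q n) :=
      Measure.isProbabilityMeasure_map (measurable_of_finite _).aemeasurable
    calc rcBoxLaw d false p q n (openConnVia (withinGraph ⊤ (↑(box d N) : Set (Site d))) x y)
        ≤ rcBoxLaw d false p q n (openConn x y) := by
          refine measure_mono fun ω hω => ?_
          rw [openConn_eq_iUnion_openConnVia_box]
          exact Set.mem_iUnion.2 ⟨N, hω⟩
      _ = ENNReal.ofReal (a n) := (ENNReal.ofReal_toReal (measure_ne_top _ _)).symm
      _ ≤ ENNReal.ofReal ℓ := ENNReal.ofReal_le_ofReal (le_ciSup hbdd n)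
  have hPle' : P.real (openConn x y) ≤ ℓ := by
    rw [measureReal_def]
    have h0 : 0 ≤ ℓ := (measureReal_nonneg (μ := rcBoxLaw d false p q 0)).trans (le_ciSup hbdd 0)
    exact (ENNReal.toReal_le_toReal (measure_ne_top _ _) ENNReal.ofReal_ne_top).2 hPle |>.trans
      (ENNReal.toReal_ofReal h0).le
  rwa [show P.real (openConn x y) = ℓ from le_antisymm hPle' hℓle]

end Limit

/-! ### Infinite-volume Edwards–Sokal at `q = 2`: `P(x ↔ y) = ⟨σ_xσ_y⟩^∅_β` -/

section EdwardsSokal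

variable {β : ℝ} {P : Measure (BondConfig (Site d))}

/-- **Edwards–Sokal in infinite volume, free boundary condition**: for `β ≥ 0`, `p = 1 - e^{-2β}` and
every free box limit `P` of the FK–Ising (`q = 2`) box laws on `ℤ^d`,
`P(x ↔ y) = ⟨σ_xσ_y⟩^∅_{β,0}` for all `x, y` (Grimmett 2006, Thm. (4.91) / first display of the proof
of (5.18), p. 107: `(1 - q⁻¹) φ⁰_{p,q}(0 ↔ u) = π_{β,q}(σ_0 = σ_u) - q⁻¹`, at `q = 2`). Both sides are
the limit of `φ⁰_{Λ_n,p,2}(x ↔ y) = ⟨σ_xσ_y⟩^∅_{Λ_n;β,0}` (finite-volume Edwards–Sokal): the left by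
`IsBoxLimit.tendsto_rcBoxLaw_real_openConn`, the right by the existence of the free Ising state
(`tendsto_isingTwoPoint_free_pair` with `hasBoxLimit_isingCorr_free_holds`).
[cite: Grimmett2006, Thm. (4.91) and Thm. (5.17), proof of (5.18), p. 107] [cite: EdwardsSokal1988] -/
theorem IsBoxLimit.real_openConn_eq_freePair (hP : IsBoxLimit d false (fkIsingParam β) 2 P)
    (hβ : 0 ≤ β) (x y : Site d) : P.real (openConn x y) = freePair d β x y := by
  have h1 := hP.tendsto_rcBoxLaw_real_openConn (fkIsingParam_mem_Icc hβ) (by norm_num) x y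
  have h2 : Tendsto (fun n : ℕ => isingTwoPoint (zdGraph d) (box d n) β 0 .free x y) atTop
      (𝓝 (freePair d β x y)) :=
    tendsto_isingTwoPoint_free_pair hasBoxLimit_isingCorr_free_holds hβ x y
  have h12 : (fun n : ℕ => (rcBoxLaw d false (fkIsingParam β) 2 n).real (openConn x y)) =ᶠ[atTop]
      fun n : ℕ => isingTwoPoint (zdGraph d) (box d n) β 0 .free x y := by
    filter_upwards [eventually_mem_box x, eventually_mem_box y] with n hx hy
    exact rcBoxLaw_real_openConn_eq_isingTwoPoint hβ hx hy
  exact tendsto_nhds_unique (h1.congr' h12) h2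

/-- In particular `P(x ↔ y) ≤ ⟨σ_xσ_y⟩^∅_{β,0}`. [cite: Grimmett2006, Thm. (5.17), proof of (5.18), p. 107] -/
theorem IsBoxLimit.real_openConn_le_freePair (hP : IsBoxLimit d false (fkIsingParam β) 2 P)
    (hβ : 0 ≤ β) (x y : Site d) : P.real (openConn x y) ≤ freePair d β x y :=
  (hP.real_openConn_eq_freePair hβ x y).le

end EdwardsSokal

/-! ### The lower half of (5.32): `P(0 ↔ ∞)² ≲ M̃_LRO(β)²` -/

section Density

variable {β : ℝ} {P : Measure (BondConfig (Site d))}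

/-- **(5.32), lower half, pointwise** (Grimmett 2006, proof of (5.18), p. 107: "by the 0/1-infinite-cluster
property of `φ⁰_{p,q}` … `φ⁰(0 ↔ u) ≥ φ⁰(0 ↔ ∞, u ↔ ∞)`", then FKG): for a positively associated,
translation-invariant free FK–Ising box limit `P` (`p = 1 - e^{-2β}`, `β ≥ 0`) with a.s. at most one
infinite cluster, `P(0 ↔ ∞)² = P(x ↔ ∞) P(y ↔ ∞) ≤ P(x ↔ ∞, y ↔ ∞) ≤ P(x ↔ y) = ⟨σ_xσ_y⟩^∅_{β,0}`.
[cite: Grimmett2006, Thm. (5.17), proof of (5.18), (5.32), p. 107] -/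
theorem IsBoxLimit.sq_real_percolatesAt_le_freePair (hP : IsBoxLimit d false (fkIsingParam β) 2 P)
    (hβ : 0 ≤ β) (hPA : IsPositivelyAssociated P)
    (hT : ∀ v : Site d, MeasurePreserving (BondConfig.relabel (sym2Equiv (Site.shift v))) P P)
    (huniq : ∀ᵐ ω ∂P, numInfiniteClusters ω ≤ 1) (x y : Site d) :
    P.real (percolatesAt (0 : Site d)) ^ 2 ≤ freePair d β x y := by
  haveI := hP.isProbabilityMeasure
  calc P.real (percolatesAt (0 : Site d)) ^ 2
      = P.real (percolatesAt x) * P.real (percolatesAt y) := by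
        rw [sq, measureReal_percolatesAt_eq_of_invariant P hT x,
          measureReal_percolatesAt_eq_of_invariant P hT y]
    _ ≤ P.real (percolatesAt x ∩ percolatesAt y) :=
        hPA.real (isUpperSet_percolatesAt x) (isUpperSet_percolatesAt y)
          (measurableSet_percolatesAt_holds x) (measurableSet_percolatesAt_holds y)
    _ ≤ P.real (openConn x y) := measureReal_percolatesAt_inter_le P huniq x y
    _ = freePair d β x y := hP.real_openConn_eq_freePair hβ x y

/-- **`P(0 ↔ ∞)² ≤ M̃_LRO(β)²` under a.s. uniqueness** (free FK–Ising box limit `P` at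
`p = 1 - e^{-2β}`, `β ≥ 0`, translation invariant, a.s. at most one infinite cluster): the
Cauchy–Schwarz density bound of ADS15 Thm. 3.1 (tree `sq_measureReal_percolatesAt_le_of_le`, stated
there for an arbitrary invariant measure — no FKG needed) with `P(x ↔ y) ≤ ⟨σ_xσ_y⟩^∅_β`, and
`M̃_LRO(β)² = inf_B |B|⁻² ∑_{x,y∈B} ⟨σ_xσ_y⟩^∅_β`. With FO-03a: `P(0 ↔ ∞)² ≤ M̃_LRO(β)² ≤ θ⁰(p,2)`.
[cite: AizenmanDuminilCopinSidoraviciusCMP2015, Thm. 3.1, eqs. (3.4)–(3.5)] [cite: Grimmett2006, Thm. (5.17), proof of (5.18), (5.32), p. 107] -/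
theorem IsBoxLimit.sq_real_percolatesAt_le_lroTildeSq (hP : IsBoxLimit d false (fkIsingParam β) 2 P)
    (hβ : 0 ≤ β)
    (hT : ∀ v : Site d, MeasurePreserving (BondConfig.relabel (sym2Equiv (Site.shift v))) P P)
    (huniq : ∀ᵐ ω ∂P, numInfiniteClusters ω ≤ 1) :
    P.real (percolatesAt (0 : Site d)) ^ 2 ≤ lroTildeSq d β := by
  haveI := hP.isProbabilityMeasure
  refine le_lroTildeSq d fun B hB => ?_
  rw [freeBlockAverage_def]
  exact sq_measureReal_percolatesAt_le_of_le P hT huniq (freePair d β) (hP.real_openConn_le_freePair hβ) hB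

/-- **`P(0 ↔ ∞)² ≤ 2 M̃_LRO(β)²` without uniqueness/ergodicity**: if the translation-invariant free
FK–Ising box limit `P` has a.s. no three infinite clusters, the percolating sites of a block fall into at
most two classes and `(a+b)² ≤ 2(a²+b²)` (tree `sq_measureReal_percolatesAt_le_two_mul`).
[cite: AizenmanDuminilCopinSidoraviciusCMP2015, Thm. 3.1, eqs. (3.4)–(3.5)] [cite: BurtonKeane1989] -/
theorem IsBoxLimit.sq_real_percolatesAt_le_two_mul_lroTildeSq
    (hP : IsBoxLimit d false (fkIsingParam β) 2 P) (hβ : 0 ≤ β)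
    (hT : ∀ v : Site d, MeasurePreserving (BondConfig.relabel (sym2Equiv (Site.shift v))) P P)
    (h3 : P (threeInfClusters (Site d)) = 0) :
    P.real (percolatesAt (0 : Site d)) ^ 2 ≤ 2 * lroTildeSq d β := by
  haveI := hP.isProbabilityMeasure
  suffices h : P.real (percolatesAt (0 : Site d)) ^ 2 / 2 ≤ lroTildeSq d β by linarith
  refine le_lroTildeSq d fun B hB => ?_
  have hcard : (0 : ℝ) < (#B : ℝ) ^ 2 := by
    have : (0 : ℝ) < #B := by exact_mod_cast hB.card_pos
    positivity
  have h1 := sq_measureReal_percolatesAt_le_two_mul P hT h3 hB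
  have h2 : ∑ x ∈ B, ∑ y ∈ B, P.real (openConn x y) ≤ ∑ x ∈ B, ∑ y ∈ B, freePair d β x y :=
    sum_le_sum fun x _ => sum_le_sum fun y _ => hP.real_openConn_le_freePair hβ x y
  rw [freeBlockAverage_def, div_le_iff₀ (by norm_num : (0 : ℝ) < 2)]
  calc P.real (percolatesAt (0 : Site d)) ^ 2
      ≤ 2 * (∑ x ∈ B, ∑ y ∈ B, P.real (openConn x y)) / (#B : ℝ) ^ 2 := h1
    _ ≤ 2 * (∑ x ∈ B, ∑ y ∈ B, freePair d β x y) / (#B : ℝ) ^ 2 := by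
        gcongr
    _ = (∑ x ∈ B, ∑ y ∈ B, freePair d β x y) / (#B : ℝ) ^ 2 * 2 := by ring

/-- If `M̃_LRO(β)² = 0`, some nonempty finite block has average free pair correlation below any
`ε > 0`. [cite: AizenmanDuminilCopinSidoraviciusCMP2015, §1.3, eq. (1.9)] -/
theorem exists_freeBlockAverage_lt_of_lroTildeSq_eq_zero (h0 : lroTildeSq d β = 0) {ε : ℝ}
    (hε : 0 < ε) : ∃ B : Finset (Site d), B.Nonempty ∧
      (∑ x ∈ B, ∑ y ∈ B, freePair d β x y) / (#B : ℝ) ^ 2 < ε := by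
  have h : sInf (freeBlockAverage d β '' {B : Finset (Site d) | B.Nonempty}) < ε := by
    rw [show sInf (freeBlockAverage d β '' {B : Finset (Site d) | B.Nonempty}) = lroTildeSq d β from rfl,
      h0]
    exact hε
  obtain ⟨_, ⟨B, hB, rfl⟩, hlt⟩ := exists_lt_of_csInf_lt (lroTildeSq_set_nonempty d β) h
  exact ⟨B, hB, by rwa [freeBlockAverage_def] at hlt⟩

/-- **Row FO-03b by percolation methods: `M̃_LRO(β) = 0 ⇒ P(x ↔ ∞) = 0`** for every
translation-invariant, insertion-tolerant free FK–Ising box limit `P` on `ℤ^d` (`d ≥ 1`) at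
`p = 1 - e^{-2β}`, `β ≥ 0`: Grimmett's route to the '⇐' half of (5.18) (infinite-volume measure,
Burton–Keane, translation invariance) with ADS15 Thm. 3.1's Cauchy–Schwarz bound in place of FKG and NO
random-current input (contrast `FK.thetaFree_eq_zero_of_lroTildeSq_eq_zero`, through ADS15 Thm. 1.2).
`hS`, `hT`, `hI` are the conclusions of `IsBoxLimit.ae_subset_edgeSet`, `.measurePreserving_relabel_shift`,
`.insertion_tolerant` of the cell's construction files.
[cite: Grimmett2006, Thm. (5.17), proof of (5.18), (5.32), p. 107] [cite: AizenmanDuminilCopinSidoraviciusCMP2015, Thm. 3.1] [cite: BurtonKeane1989] -/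
theorem IsBoxLimit.measure_percolatesAt_eq_zero_of_lroTildeSq_eq_zero (hd : 1 ≤ d)
    (hP : IsBoxLimit d false (fkIsingParam β) 2 P) (hβ : 0 ≤ β)
    (hS : ∀ᵐ ω ∂P, ω ⊆ (zdGraph d).edgeSet)
    (hT : ∀ v : Site d, MeasurePreserving (BondConfig.relabel (sym2Equiv (Site.shift v))) P P)
    (hI : ∀ N : ℕ, ∃ c : ℝ, 0 < c ∧ ∀ {S : Set (BondConfig (Site d))}, MeasurableSet S →
      c * P.real (openEdges ↑(edgesIn (zdGraph d) (box d N)) ⁻¹' S) ≤ P.real S)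
    (h0 : lroTildeSq d β = 0) (x : Site d) : P (percolatesAt x) = 0 := by
  haveI := hP.isProbabilityMeasure
  have hI' : ∀ n : ℕ, ∃ c : ℝ, 0 < c ∧ ∀ E : Set (BondConfig (Site d)), MeasurableSet E →
      c * P.real (openEdges ↑(edgesIn (zdGraph d) (box d n)) ⁻¹' E) ≤ P.real E := fun n => by
    obtain ⟨c, hc, h⟩ := hI n
    exact ⟨c, hc, fun E hE => h hE⟩
  exact measure_percolatesAt_eq_zero_of_insertionTolerant hd P hS hT hI' (freePair d β)
    (hP.real_openConn_le_freePair hβ) (fun ε hε => exists_freeBlockAverage_lt_of_lroTildeSq_eq_zero h0 hε) x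

end Density

end FK

end Summit.CriticalPhenomena.PercolationContinuityZ3.Theorems

end
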